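import Summits.BirchSwinnertonDyer.BirchSwinnertonDyer.Theses.EisensteinPrimes
import Literature.NumberTheory.EllipticCurves.Kato2004.DivisibilityInputs
import Literature.NumberTheory.EllipticCurves.CriticalSlopePAdicLFunction

/-!
# Crux idea `critical-slope-coprimality` — typed sketch (planner-bsd-eis-idea-g7-0, 2026-08-27)

Crux (fixed): `Summit.BirchSwinnertonDyer.BirchSwinnertonDyer.Theses.EisensteinPrimes.MazurMCOnX1RankZero`.

LEVER (new relative to the cone g0–g6): the CRITICAL-SLOPE refinement `f_β` (`β = p/α`, `v_p(β) = 1`)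
of the newform of `E₀` and its Pollack–Stevens / Bellaïche `p`-adic `L`-function
`L_β = criticalSlopePAdicLFunctionOf E₀ f β` as a SECOND, independent `p`-adic measurement of Kato's
zeta element.  Write `𝐇¹(T_pE) = Λ·b`, `z_Kato = g·b` (zeta index `g ∈ Λ`).  Both refinements see the
SAME global index: `L_α = g·Col_α(loc_p b)` (Kato Thm. 16.6) and `L_β = g·Col_β(loc_p b)` (critical-
slope explicit reciprocity, Loeffler–Zerbes 2014 / Hansen 2016), while by Perrin-Riou's determinant
formula the pair `(Col_α, Col_β)` is injective on `H¹(ℚ_p, V ⊗ ρ)` at every non-exceptional character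
`ρ` of the open disc.  Hence every zero of `g` is a COMMON zero of `L_α` and `L_β`, and — away from
strict-Selmer support, which is EMPTY when no bad prime is `≡ 1 (mod p)` — conversely.  So on that
regime Mazur's MC is EQUIVALENT to: `L_α(E₀,T) ∈ Λ` and `L_β(E₀,T) ∈ 𝓗₁` have no common
non-exceptional zero in the open unit disc (+ `μ(L_α) = 0`) — a statement about two COMPUTABLE
`p`-adic analytic functions, decidable per pair, with no Selmer lower bound anywhere.

Everything below is statement-only except the composition theorems and the index algebra (sorry-free).
-/

open CongruenceSubgroup WeierstrassCurve
open Literature.NumberTheory.EllipticCurves Literature.NumberTheory.EllipticCurves.ModularForms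
open Literature.NumberTheory.EllipticCurves.Rank1Residual
open Literature.NumberTheory.EllipticCurves.Kato2004
open Literature.NumberTheory.EllipticCurves.OMSWeightTwo
open Summit.BirchSwinnertonDyer.BirchSwinnertonDyer.Theorems.Rank1ResidualX1Defs
open Summit.BirchSwinnertonDyer.BirchSwinnertonDyer.Theses.EisensteinPrimes

namespace Summit.BirchSwinnertonDyer.BirchSwinnertonDyer.Cruxes.MazurMCOnX1RankZero.CriticalSlopeCoprimality

noncomputable section

variable (p : ℕ) [Fact p.Prime]

/-! ## Analytic side: zeros in the open disc, exceptional points, the coprimality statement -/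

/-- `F ∈ ℚ_p⟦T⟧` has a zero at the point `ρ` of `ℚ̄_p` (the series `∑ F_k ρ^k` converges to `0`). -/
def HasDiscZero (F : PowerSeries ℚ_[p]) (ρ : PadicAlgCl p) : Prop :=
  HasSum (fun k : ℕ => (algebraMap ℚ_[p] (PadicAlgCl p) (PowerSeries.coeff k F)) * ρ ^ k) 0

/-- Exceptional points of the open disc: `ρ = γ^e·ζ − 1` with `ζ ∈ μ_{p^∞}`, `e ∈ {−1, 0, 1}`
(`γ = cyclotomicGenerator p`): the finite-order characters and their `χ_cyc^{±1}`-shifts, where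
Perrin-Riou's rank-two regulator of `V_pE` (Hodge–Tate weights `0, 1`) may drop rank. -/
def IsExceptionalPoint (ρ : PadicAlgCl p) : Prop :=
  ∃ (n : ℕ) (ζ : PadicAlgCl p) (e : ℤ), ζ ^ (p ^ n) = 1 ∧ -1 ≤ e ∧ e ≤ 1 ∧
    ρ = ((cyclotomicGenerator p : ℕ) : PadicAlgCl p) ^ e * ζ - 1

/-- The non-unit root `β = p/α` of `X² − a_pX + p` at a good ordinary prime (`α = unitRoot W p`). -/
def betaRoot (W : WeierstrassCurve ℚ) [W.IsElliptic] [W.IsGloballyMinimal] : ℚ_[p] := (p : ℚ_[p]) / ((unitRoot W p : ℤ_[p]) : ℚ_[p])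

/-- **C⁺ — TWO-REFINEMENT COPRIMALITY at `(W, p)` (the transferred crux; analytic, per pair decidable).**
For the newform `f` of `W`: the unit-root `p`-adic `L`-function `L_α = padicLFunction f α ∈ ℚ_p⟦T⟧`
and the critical-slope one `L_β = criticalSlopePAdicLFunctionOf W f β` (Pollack–Stevens eigen-lift;
junk `0` if `f_β` is `θ`-critical, which makes the statement FALSE there — intended) have no common
zero `ρ`, `‖ρ‖ < 1`, outside the exceptional points. -/
def CoprimeRefinements (W : WeierstrassCurve ℚ) [W.IsElliptic] [W.IsGloballyMinimal] : Prop :=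
  ∀ {N : ℕ} [NeZero N] (f : CuspForm (Gamma0 N) 2), IsNewformOf W f →
    ∀ ρ : PadicAlgCl p, ‖ρ‖ < 1 → ¬ IsExceptionalPoint p ρ →
      HasDiscZero p (padicLFunction f ((unitRoot W p : ℤ_[p]) : ℚ_[p])) ρ →
      ¬ HasDiscZero p (criticalSlopePAdicLFunctionOf W f (betaRoot p W)) ρ

/-- Census bookkeeping regime (no bad prime `ℓ ≡ 1 (mod p)`; 235 of the 770 leaf classes `N < 2·10⁴`,
all in the cell's regime W, including the open cells 858k1@7 and 17328bf1@5).  NOT used by the door: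
necessity of C⁺ for MC holds modulo Greenberg's fine-Selmer problem (Gr) for `E₀` (support of
`X_fine(E₀/ℚ_∞)` at cyclotomic points), since every local puncture factor vanishes only at
exceptional points `γζ − 1`; Conjecture A (`μ(X_fine) = 0`) is known here (Coates–Sujatha + FW). -/
def NoBadPrimeOneModP (W : WeierstrassCurve ℚ) : Prop :=
  ∀ (ℓ : ℕ) [Fact ℓ.Prime], ¬ W.HasGoodReductionAtPrime ℓ → ℓ % p ≠ 1

/-! ## The zeta-index datum (interface; as in idea g1, nothing asserted beyond the field list) -/

section Datum

variable (W : WeierstrassCurve ℚ) [W.IsElliptic] [W.IsGloballyMinimal]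
  [ContinuousSMul ℤ_[p] (W.tateModule p)] {N : ℕ} [NeZero N] (f : CuspForm (Gamma0 N) 2)
  (κ : ZpExtension ℚ p) (γ : Field.absoluteGaloisGroup ℚ)
  (I : IwasawaH1Data W p κ γ) (D : W.SelmerDualData κ γ)

/-- Kato's §17.13 package with a generator `b` of `𝐇¹ = Λ·b`, Kato's `z = g • b` spanning `Z`, and
`col(loc z) = L`, `ι L = ϖ·L_p(f, α)` (Kato Thm. 12.5, 16.6, 17.5; Wuthrich 2014 Thm. 2, Lemma 10). -/
structure ZetaDatum where
  K : DivisibilityInputs W p f κ γ I D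
  b : I.H
  span_b : ∀ x : I.H, ∃ r : IwasawaAlgebra p, x = r • b
  b_torsionFree : ∀ r : IwasawaAlgebra p, r • b = 0 → r = 0
  z : I.H
  g : IwasawaAlgebra p
  z_eq : z = g • b
  z_mem : z ∈ K.Z
  Z_le : ∀ x ∈ K.Z, ∃ r : IwasawaAlgebra p, x = r • z
  ϖ : ℚ
  ϖ_ne : ϖ ≠ 0
  period : (ϖ : ℝ) * W.realPeriodRat = plusPeriod f
  L : IwasawaAlgebra p
  L_eq : K.col (K.loc z) = L
  ιL_eq : iwasawaToPowerSeries p L =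
    PowerSeries.C ((ϖ : ℚ) : ℚ_[p]) * padicLFunction f (unitRoot W p : ℚ_[p])

variable {p W f κ γ I D}

/-- `h = col(loc b)`, so that `L = g * h`. -/
def ZetaDatum.h (Δ : ZetaDatum p W f κ γ I D) : IwasawaAlgebra p := Δ.K.col (Δ.K.loc Δ.b)

theorem ZetaDatum.factor (Δ : ZetaDatum p W f κ γ I D) : Δ.L = Δ.g * Δ.h := by
  rw [← Δ.L_eq, Δ.z_eq, LinearMap.map_smul, LinearMap.map_smul, smul_eq_mul]; rfl

/-- `z` generates `𝐇¹`: the zeta index is a unit. -/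
def ZetaDatum.Generates (Δ : ZetaDatum p W f κ γ I D) : Prop := IsUnit Δ.g

/-- The zeta index has no zero at the exceptional points (per pair: Rohrlich's non-vanishing of
`L(E₀, χ, 1)` for almost all cyclotomic `χ` + a finite check; class-wide an honest hypothesis). -/
def ZetaDatum.ExcClean (Δ : ZetaDatum p W f κ γ I D) : Prop :=
  ∀ ρ : PadicAlgCl p, ‖ρ‖ < 1 → IsExceptionalPoint p ρ →
    ¬ HasDiscZero p (iwasawaToPowerSeries p Δ.g) ρ

/-- `μ(L) = 0` for the datum's `L = col(loc z)` (= `μ_an = 0` at this model; per pair a computation). -/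
def ZetaDatum.MuZero (Δ : ZetaDatum p W f κ γ I D) : Prop :=
  ¬ (PowerSeries.C (p : ℤ_[p]) : IwasawaAlgebra p) ∣ Δ.L

end Datum

/-! ## The three statements of the line -/

/-- **K1 — CRITICAL-SLOPE INDEX TRANSFER (the new lever; rank 2).**  If `L_α` and `L_β` have no common
non-exceptional zero in the open disc and the zeta index `g` has no exceptional zero, then `g` has NO
zero in the open disc, i.e. `g = p^μ · u` with `u ∈ Λ^×`.  Printed inputs: `L_β = g · Col_β(loc_p b)`
(critical-slope comparison for Kato's element: Colmez's `β`-functional as in Loeffler–Zerbes 2010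
arXiv:1012.0175 §3/§6, and D. Hansen, arXiv:1508.03982 (preprint 2015) Thm. 1.2.1 «v_p(α_f) = k−1 and
V_f|G_{ℚ_p} indecomposable ⇒ L_{p,an}(f) = L_{p,alg}(f)»; needs `f_β` non-`θ`-critical, i.e.
`V_pE|G_{ℚ_p}` non-split — known for non-CM elliptic curves at weight 2, ibid. p. 4), Perrin-Riou's `δ(V)` determinant for the rank-two
regulator (injectivity off the exceptional points), Weierstrass preparation in `Λ = ℤ_p⟦T⟧`.
INTEGRAL MODEL (Loeffler–Zerbes 2010 = arXiv:1012.0175, Def. 6.2 / Thm. 1 / Prop. 6.3): in a basis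
`n₁, n₂` of the Wach module `𝐍(T_pE₀)` one has `Col(loc_p z) = L₁·(1+π)φ(n₁) + L₂·(1+π)φ(n₂)` with
`L₁, L₂ ∈ Λ` (given `z ∈ H¹_Iw(T)`), `L₂ = α·L_α`, `β·L_β = L₁·ℓ₁ − L₂·ℓ_a`; then `g ∣ L₁`, `g ∣ L₂` and
`IsRelPrime L₁ L₂ → IsUnit g` is `isUnit_of_isRelPrime_pair` below — the disc version is the
basis-free form of "the ideal `(L₁, L₂) ⊆ Λ` lies in no height-one prime". -/
def CriticalSlopeIndexTransfer : Prop :=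
  ∀ (W : WeierstrassCurve ℚ) [W.IsElliptic] [W.IsGloballyMinimal] (p : ℕ) [Fact p.Prime]
    [ContinuousSMul ℤ_[p] (W.tateModule p)] {N : ℕ} [NeZero N] (f : CuspForm (Gamma0 N) 2)
    (κ : ZpExtension ℚ p) (γ : Field.absoluteGaloisGroup ℚ)
    (I : IwasawaH1Data W p κ γ) (D : W.SelmerDualData κ γ) (Δ : ZetaDatum p W f κ γ I D),
    ClassX1 W p → W.analyticRank = 0 → κ.IsCyclotomic → κ.IsTopGenerator γ →
    IsCyclotomicVariable p γ → IsNewformOf W f → CoprimeRefinements p W → Δ.ExcClean →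
    ∃ (μ : ℕ) (u : IwasawaAlgebra p), IsUnit u ∧ Δ.g = (PowerSeries.C (p : ℤ_[p])) ^ μ * u

/-- **K2 (= idea g1's K3, shared support; Kato 2004 §17.13 with Thm. 12.5(3)/13.4, Wuthrich 2014,
Coates–Sujatha 2005 Cor. 3.6): if Kato's zeta element generates `𝐇¹(T_pW)`, Mazur's MC holds.** -/
def MazurOfGenerates : Prop :=
  ∀ (W : WeierstrassCurve ℚ) [W.IsElliptic] [W.IsGloballyMinimal] (p : ℕ) [Fact p.Prime]
    [ContinuousSMul ℤ_[p] (W.tateModule p)] {N : ℕ} [NeZero N] (f : CuspForm (Gamma0 N) 2)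
    (κ : ZpExtension ℚ p) (γ : Field.absoluteGaloisGroup ℚ)
    (I : IwasawaH1Data W p κ γ) (D : W.SelmerDualData κ γ) (Δ : ZetaDatum p W f κ γ I D),
    ClassX1 W p → W.analyticRank = 0 → κ.IsCyclotomic → κ.IsTopGenerator γ →
    IsCyclotomicVariable p γ → IsNewformOf W f → Δ.Generates → MazurMainConjecture W p

/-- **K0 — the datum exists on the regime `R` and the class reduces to it** (construction statement:
Kato 12.5/12.6/16.6/17.5, Wuthrich 2014 Thm. 2 + Lemma 10, the tree's `exists_divisibilityInputs`,
rank-0 isogeny invariance `Rank1ResidualX1Isogeny.mazurMainConjecture_iff_of_isIsogenous_of_analyticRank_eq_zero`;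
the per-pair checks `ExcClean`, `MuZero` are carried as regime output). -/
def ZetaDatumExists (R : ∀ (W : WeierstrassCurve ℚ) (p : ℕ), Prop) : Prop :=
  ∀ (W : WeierstrassCurve ℚ) [W.IsElliptic] [W.IsGloballyMinimal] (p : ℕ) [Fact p.Prime],
    ClassX1 W p → W.analyticRank = 0 → R W p →
    ∃ (W' : WeierstrassCurve ℚ) (_ : W'.IsElliptic) (_ : W'.IsGloballyMinimal)
      (_ : ContinuousSMul ℤ_[p] (W'.tateModule p)) (N : ℕ) (_ : NeZero N) (f : CuspForm (Gamma0 N) 2)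
      (κ : ZpExtension ℚ p) (γ : Field.absoluteGaloisGroup ℚ)
      (I : IwasawaH1Data W' p κ γ) (D : W'.SelmerDualData κ γ) (Δ : ZetaDatum p W' f κ γ I D),
      ClassX1 W' p ∧ W'.analyticRank = 0 ∧ κ.IsCyclotomic ∧ κ.IsTopGenerator γ ∧
      IsCyclotomicVariable p γ ∧ IsNewformOf W' f ∧ CoprimeRefinements p W' ∧ Δ.ExcClean ∧
      Δ.MuZero ∧ (MazurMainConjecture W' p → MazurMainConjecture W p)

/-! ## Pure algebra (PROVED): the index is a unit -/

theorem isUnit_of_eq_pPow_mul_unit_of_not_dvd (g h L u : IwasawaAlgebra p) (μ : ℕ)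
    (hL : L = g * h) (hu : IsUnit u) (hg : g = (PowerSeries.C (p : ℤ_[p])) ^ μ * u)
    (hμ : ¬ (PowerSeries.C (p : ℤ_[p]) : IwasawaAlgebra p) ∣ L) : IsUnit g := by
  rcases Nat.eq_zero_or_pos μ with h0 | hpos
  · subst h0; simpa [hg] using hu
  · exfalso; apply hμ
    refine ⟨(PowerSeries.C (p : ℤ_[p])) ^ (μ - 1) * u * h, ?_⟩
    rw [hL, hg]
    have : (PowerSeries.C (p : ℤ_[p]) : IwasawaAlgebra p) ^ μ =
        PowerSeries.C (p : ℤ_[p]) * (PowerSeries.C (p : ℤ_[p])) ^ (μ - 1) := by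
      rw [← pow_succ']; congr 1; omega
    rw [this]; ring

/-- The naive form of the lever: a common divisor of the two refinements divides the index, so
RELATIVE PRIMALITY of `(L♯, L♭)`-type integral avatars forces `IsUnit g` (used on the card only as
the model statement; the disc version is K1). -/
theorem isUnit_of_isRelPrime_pair {R : Type*} [CommMonoid R] (g hs hf Ls Lf : R)
    (h1 : Ls = g * hs) (h2 : Lf = g * hf) (hrel : IsRelPrime Ls Lf) : IsUnit g :=
  hrel (Dvd.intro hs h1.symm) (Dvd.intro hf h2.symm)

/-! ## Composition (sorry-free): K0 ∧ K1 ∧ K2 decide the crux on the regime `R` -/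

theorem mazurMC_of_regime (R : ∀ (W : WeierstrassCurve ℚ) (p : ℕ), Prop)
    (h0 : ZetaDatumExists R) (h1 : CriticalSlopeIndexTransfer) (h2 : MazurOfGenerates)
    (W : WeierstrassCurve ℚ) [W.IsElliptic] [W.IsGloballyMinimal] (p : ℕ) [Fact p.Prime]
    (hX1 : ClassX1 W p) (hr0 : W.analyticRank = 0) (hR : R W p) :
    MazurMainConjecture W p := by
  obtain ⟨W', _, _, _, N, _, f, κ, γ, I, D, Δ, hX1', hr0', hκ, hγ, hcv, hf, hcop, hexc, hμ, htr⟩ :=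
    h0 W p hX1 hr0 hR
  obtain ⟨μ, u, hu, hg⟩ := h1 W' p f κ γ I D Δ hX1' hr0' hκ hγ hcv hf hcop hexc
  have hgen : Δ.Generates :=
    isUnit_of_eq_pPow_mul_unit_of_not_dvd p Δ.g Δ.h Δ.L u μ Δ.factor hu hg hμ
  exact htr (h2 W' p f κ γ I D Δ hX1' hr0' hκ hγ hcv hf hgen)

/-- **The crux by name**, with the regime discharged (`hR` is the honest residual: pairs whose
`L_α`, `L_β` DO share a non-exceptional zero (conjecturally = non-exceptional support of `X_fine(E₀)`,
Greenberg's problem (Gr)), `θ`-critical `f_β` (CM only), an exceptional zero of the index `g`, or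
`μ(L_α) > 0` at every member of the class are NOT decided by this line). -/
theorem MazurMCOnX1RankZero_of (R : ∀ (W : WeierstrassCurve ℚ) (p : ℕ), Prop)
    (h0 : ZetaDatumExists R) (h1 : CriticalSlopeIndexTransfer) (h2 : MazurOfGenerates)
    (hR : ∀ (W : WeierstrassCurve ℚ) [W.IsElliptic] [W.IsGloballyMinimal] (p : ℕ) [Fact p.Prime],
      ClassX1 W p → W.analyticRank = 0 → R W p) :
    MazurMCOnX1RankZero := by
  intro W _ _ p _ hX1 hr0
  exact mazurMC_of_regime R h0 h1 h2 W p hX1 hr0 (hR W p hX1 hr0)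

end

end Summit.BirchSwinnertonDyer.BirchSwinnertonDyer.Cruxes.MazurMCOnX1RankZero.CriticalSlopeCoprimality
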